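import Summits.Ventures.YMGap.Thresholds.HaarFourthMomentSUNCross
import Summits.Ventures.YMGap.Thresholds.HaarFourthMomentSU2Entries
import HarnessLib

/-!
# Route `ToronCumulantSign`, crux `CommutatorSkewMoment` (stmt-QuantumFields-27530) — helper II:
# the modulus moments of bidegree `(2,2)` of `SU(N)` at ARBITRARY index positions, every `N ≥ 2`

For a compact group `G ≅ SU(N)` (`IsSpecialUnitaryModel ρ`), `N = 2 + n ≥ 2`, the four values of
`∫ |ρ_{r₁c₁}|² |ρ_{r₂c₂}|² dg` (Creutz (8.22); Collins–Śniady Cor. 2.4):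
* same entry: `A = 2/(N(N+1))` (`integral_nn_same`);
* same row, different columns, or same column, different rows: `B = 1/(N(N+1))` (`integral_nn_row`, `integral_nn_col`);
* different rows and different columns: `C = 1/(N² − 1)` (`integral_nn_gen`),
transported from the tree's values at the positions `(0,0),(0,1),(1,0),(1,1)` (venture files `HaarFourthMomentSUN`, `N ≥ 3`, and
`HaarFourthMomentSU2Entries`, `N = 2`) by signed transpositions acting on rows (left) and columns (right), with `B` and `C`
DERIVED from `A` by the unitarity row/column sums (so `N = 2` needs only `∫|U₀₀|⁴ = 1/3`).  Consequences used by the crux: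
the diagonal sums `Σ_m ∫ |ρ_mm|²|ρ_ii|² = (N+2)/(N(N+1))` (`sum_integral_nn_diag_same`) and, for `i ≠ k`,
`Σ_m ∫ |ρ_mm|²|ρ_ik|² = (N²−2)/(N(N²−1))` (`sum_integral_nn_diag_off`).  HONEST LABEL: pure compact-group integration; helper
toward the OPEN crux `CommutatorSkewMoment`; nothing about the Yang–Mills mass gap.

References: M. Creutz, *Quarks, gluons and lattices* (1983) §8 (8.22); B. Collins, P. Śniady, CMP 264 (2006), Cor. 2.4.
-/

noncomputable section

open MeasureTheory Complex
open Literature.MathematicalPhysics.QuantumLattice Literature.MathematicalPhysics.QuantumFieldTheory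

namespace Summit.QuantumFields.YangMills.Theorems.ToronCumulantSign

open Summit.Ventures.YMGap.RobustBall.HaarSecondMoments (integral_comp_mul_left integral_comp_mul_right swap_mul_sign_mem)
open Summit.Ventures.YMGap

section Moments

variable {n : ℕ} {G : Type*} [Group G] [TopologicalSpace G] [IsTopologicalGroup G] [CompactSpace G]
  [MeasurableSpace G] [BorelSpace G] (ρ : G →* Matrix (Fin (2 + n)) (Fin (2 + n)) ℂ)

/-- Local shorthand: the signed transposition `swap(a,b) · diag(−1 at a)` (an element of `SU(N)` for `a ≠ b`). -/
local notation3 (prettyPrint := false) "sT" a:max b:max =>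
  (Matrix.swap ℂ a b * Matrix.diagonal (Pi.mulSingle a (-1 : ℂ)) : Matrix (Fin (2 + n)) (Fin (2 + n)) ℂ)

/-- Local shorthand: the product of two squared moduli of entries, `|M_{r₁c₁}|² |M_{r₂c₂}|²`. -/
local notation3 (prettyPrint := false) "nn" M:max r₁:max c₁:max r₂:max c₂:max =>
  Complex.normSq (M r₁ c₁) * Complex.normSq (M r₂ c₂)

/-! ### Transport of index positions by signed transpositions -/

/-- `|(T X)_{rc}|² = |X_{σ r, c}|²` for the signed transposition `T` of `a ≠ b`, `σ = (a b)`. [folklore] -/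
theorem normSq_signedSwap_mul {a b : Fin (2 + n)} (hab : a ≠ b) (X : Matrix (Fin (2 + n)) (Fin (2 + n)) ℂ)
    (r c : Fin (2 + n)) : Complex.normSq ((sT a b * X) r c) = Complex.normSq (X (Equiv.swap a b r) c) := by
  rw [Matrix.mul_assoc]
  by_cases hra : r = a
  · rw [hra, Matrix.swap_mul_apply_left, Matrix.diagonal_mul, Equiv.swap_apply_left]
    simp [Pi.mulSingle_eq_of_ne hab.symm]
  · by_cases hrb : r = b
    · rw [hrb, Matrix.swap_mul_apply_right, Matrix.diagonal_mul, Equiv.swap_apply_right]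
      simp
    · rw [Matrix.swap_mul_of_ne hra hrb, Matrix.diagonal_mul, Equiv.swap_apply_of_ne_of_ne hra hrb]
      simp [Pi.mulSingle_eq_of_ne hra]

/-- `|(X T)_{rc}|² = |X_{r, σ c}|²` for the signed transposition `T` of `a ≠ b`, `σ = (a b)`. [folklore] -/
theorem normSq_mul_signedSwap {a b : Fin (2 + n)} (hab : a ≠ b) (X : Matrix (Fin (2 + n)) (Fin (2 + n)) ℂ)
    (r c : Fin (2 + n)) : Complex.normSq ((X * sT a b) r c) = Complex.normSq (X r (Equiv.swap a b c)) := by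
  rw [← Matrix.mul_assoc, Matrix.mul_diagonal]
  by_cases hca : c = a
  · rw [hca, Matrix.mul_swap_apply_left, Equiv.swap_apply_left]; simp
  · by_cases hcb : c = b
    · rw [hcb, Matrix.mul_swap_apply_right, Equiv.swap_apply_right]; simp [Pi.mulSingle_eq_of_ne hab.symm]
    · rw [Matrix.mul_swap_of_ne hca hcb, Equiv.swap_apply_of_ne_of_ne hca hcb]
      simp [Pi.mulSingle_eq_of_ne hca]

/-- **Row transport**: `∫ |ρ_{r₁c₁}|²|ρ_{r₂c₂}|² = ∫ |ρ_{σr₁,c₁}|²|ρ_{σr₂,c₂}|²` for `σ = (a b)`, `a ≠ b`. [folklore] -/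
theorem integral_nn_swap_rows (hρ : IsSpecialUnitaryModel ρ) {a b : Fin (2 + n)} (hab : a ≠ b)
    (r₁ c₁ r₂ c₂ : Fin (2 + n)) :
    ∫ g, nn (ρ g) r₁ c₁ r₂ c₂ ∂haarProbability G =
      ∫ g, nn (ρ g) (Equiv.swap a b r₁) c₁ (Equiv.swap a b r₂) c₂ ∂haarProbability G := by
  have h := integral_comp_mul_left ρ hρ (swap_mul_sign_mem a b hab) (fun M => nn M r₁ c₁ r₂ c₂)
  beta_reduce at h
  rw [← h]
  simp_rw [normSq_signedSwap_mul hab]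

/-- **Column transport**: `∫ |ρ_{r₁c₁}|²|ρ_{r₂c₂}|² = ∫ |ρ_{r₁,σc₁}|²|ρ_{r₂,σc₂}|²` for `σ = (a b)`, `a ≠ b`. [folklore] -/
theorem integral_nn_swap_cols (hρ : IsSpecialUnitaryModel ρ) {a b : Fin (2 + n)} (hab : a ≠ b)
    (r₁ c₁ r₂ c₂ : Fin (2 + n)) :
    ∫ g, nn (ρ g) r₁ c₁ r₂ c₂ ∂haarProbability G =
      ∫ g, nn (ρ g) r₁ (Equiv.swap a b c₁) r₂ (Equiv.swap a b c₂) ∂haarProbability G := by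
  have h := integral_comp_mul_right ρ hρ (swap_mul_sign_mem a b hab) (fun M => nn M r₁ c₁ r₂ c₂)
  beta_reduce at h
  rw [← h]
  simp_rw [normSq_mul_signedSwap hab]

/-- **Rows to canonical position, distinct rows**: `∫ |ρ_{r₁c₁}|²|ρ_{r₂c₂}|² = ∫ |ρ_{0c₁}|²|ρ_{1c₂}|²` (`r₁ ≠ r₂`). [folklore] -/
theorem integral_nn_rows01 (hρ : IsSpecialUnitaryModel ρ) {r₁ r₂ : Fin (2 + n)} (h : r₁ ≠ r₂) (c₁ c₂ : Fin (2 + n)) :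
    ∫ g, nn (ρ g) r₁ c₁ r₂ c₂ ∂haarProbability G = ∫ g, nn (ρ g) 0 c₁ 1 c₂ ∂haarProbability G := by
  -- step 1: move `r₁` to `0`
  have step1 : ∃ r : Fin (2 + n), r ≠ 0 ∧
      ∫ g, nn (ρ g) r₁ c₁ r₂ c₂ ∂haarProbability G = ∫ g, nn (ρ g) 0 c₁ r c₂ ∂haarProbability G := by
    rcases eq_or_ne r₁ 0 with h0 | h0
    · subst h0; exact ⟨r₂, h.symm, rfl⟩
    · refine ⟨Equiv.swap r₁ 0 r₂, ?_, ?_⟩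
      · intro h'
        have h'' := congrArg (Equiv.swap r₁ 0) h'
        rw [Equiv.swap_apply_self, Equiv.swap_apply_right] at h''
        exact h h''.symm
      · rw [integral_nn_swap_rows ρ hρ h0 r₁ c₁ r₂ c₂, Equiv.swap_apply_left]
  obtain ⟨r, hr0, hr⟩ := step1
  rw [hr]
  -- step 2: move `r` to `1`, fixing `0`
  rcases eq_or_ne r 1 with h1 | h1
  · rw [h1]
  · rw [integral_nn_swap_rows ρ hρ h1 0 c₁ r c₂, Equiv.swap_apply_left,
      Equiv.swap_apply_of_ne_of_ne hr0.symm HaarFourthMomentSUN.one_ne_zero_fin.symm]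

/-- **Rows to canonical position, equal rows**: `∫ |ρ_{rc₁}|²|ρ_{rc₂}|² = ∫ |ρ_{0c₁}|²|ρ_{0c₂}|²`. [folklore] -/
theorem integral_nn_rows00 (hρ : IsSpecialUnitaryModel ρ) (r c₁ c₂ : Fin (2 + n)) :
    ∫ g, nn (ρ g) r c₁ r c₂ ∂haarProbability G = ∫ g, nn (ρ g) 0 c₁ 0 c₂ ∂haarProbability G := by
  rcases eq_or_ne r 0 with h0 | h0
  · rw [h0]
  · rw [integral_nn_swap_rows ρ hρ h0 r c₁ r c₂, Equiv.swap_apply_left]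

/-- **Columns to canonical position, distinct columns**: `∫ |ρ_{r₁c₁}|²|ρ_{r₂c₂}|² = ∫ |ρ_{r₁0}|²|ρ_{r₂1}|²` (`c₁ ≠ c₂`). [folklore] -/
theorem integral_nn_cols01 (hρ : IsSpecialUnitaryModel ρ) {c₁ c₂ : Fin (2 + n)} (h : c₁ ≠ c₂) (r₁ r₂ : Fin (2 + n)) :
    ∫ g, nn (ρ g) r₁ c₁ r₂ c₂ ∂haarProbability G = ∫ g, nn (ρ g) r₁ 0 r₂ 1 ∂haarProbability G := by
  have step1 : ∃ c : Fin (2 + n), c ≠ 0 ∧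
      ∫ g, nn (ρ g) r₁ c₁ r₂ c₂ ∂haarProbability G = ∫ g, nn (ρ g) r₁ 0 r₂ c ∂haarProbability G := by
    rcases eq_or_ne c₁ 0 with h0 | h0
    · subst h0; exact ⟨c₂, h.symm, rfl⟩
    · refine ⟨Equiv.swap c₁ 0 c₂, ?_, ?_⟩
      · intro h'
        have h'' := congrArg (Equiv.swap c₁ 0) h'
        rw [Equiv.swap_apply_self, Equiv.swap_apply_right] at h''
        exact h h''.symm
      · rw [integral_nn_swap_cols ρ hρ h0 r₁ c₁ r₂ c₂, Equiv.swap_apply_left]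
  obtain ⟨c, hc0, hc⟩ := step1
  rw [hc]
  rcases eq_or_ne c 1 with h1 | h1
  · rw [h1]
  · rw [integral_nn_swap_cols ρ hρ h1 r₁ 0 r₂ c, Equiv.swap_apply_left,
      Equiv.swap_apply_of_ne_of_ne hc0.symm HaarFourthMomentSUN.one_ne_zero_fin.symm]

/-- **Columns to canonical position, equal columns**: `∫ |ρ_{r₁c}|²|ρ_{r₂c}|² = ∫ |ρ_{r₁0}|²|ρ_{r₂0}|²`. [folklore] -/
theorem integral_nn_cols00 (hρ : IsSpecialUnitaryModel ρ) (c r₁ r₂ : Fin (2 + n)) :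
    ∫ g, nn (ρ g) r₁ c r₂ c ∂haarProbability G = ∫ g, nn (ρ g) r₁ 0 r₂ 0 ∂haarProbability G := by
  rcases eq_or_ne c 0 with h0 | h0
  · rw [h0]
  · rw [integral_nn_swap_cols ρ hρ h0 r₁ c r₂ c, Equiv.swap_apply_left]

/-! ### The values `A = 2/(N(N+1))`, `B = 1/(N(N+1))`, `C = 1/(N²−1)` at arbitrary positions -/

/-- Integrability of `|ρ_{r₁c₁}|²|ρ_{r₂c₂}|²`. [folklore] -/
theorem integrable_nn (hρ : Continuous ρ) (r₁ c₁ r₂ c₂ : Fin (2 + n)) :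
    Integrable (fun g => nn (ρ g) r₁ c₁ r₂ c₂) (haarProbability G) :=
  ((Complex.continuous_normSq.comp (hρ.matrix_elem r₁ c₁)).mul
    (Complex.continuous_normSq.comp (hρ.matrix_elem r₂ c₂))).integrable_of_hasCompactSupport
    (HasCompactSupport.of_compactSpace _)

/-- ★ **`A`: `∫ |ρ_{rc}|⁴ = 2/(N(N+1))`** at every position, every `N ≥ 2`. [folklore] -/
theorem integral_nn_same (hρ : IsSpecialUnitaryModel ρ) (r c : Fin (2 + n)) :
    ∫ g, nn (ρ g) r c r c ∂haarProbability G = 2 / ((2 + n : ℝ) * (3 + n)) := by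
  rw [integral_nn_rows00 ρ hρ r c c, integral_nn_cols00 ρ hρ c 0 0]
  simp_rw [← pow_two]
  rcases Nat.eq_zero_or_pos n with hn | hn
  · subst hn
    rw [HaarFourthMoment.integral_normSq_entry_sq_su2Model ρ hρ]
    norm_num
  · rw [HaarFourthMomentSUN.integral_normSq_sq ρ hρ hn]

omit [IsTopologicalGroup G] [CompactSpace G] [MeasurableSpace G] [BorelSpace G] in
/-- The unitarity row sum `Σ_c |ρ_{rc}|² = 1`. [folklore] -/
theorem sum_normSq_row (hρ : IsSpecialUnitaryModel ρ) (g : G) (r : Fin (2 + n)) :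
    ∑ c, Complex.normSq (ρ g r c) = 1 := by
  have hu := IsSpecialUnitaryModel.mem_unitaryGroup ρ hρ g
  rw [Matrix.mem_unitaryGroup_iff] at hu
  have h := congrFun (congrFun hu r) r
  rw [Matrix.mul_apply, Matrix.one_apply_eq] at h
  have h' : ∑ c, ((Complex.normSq (ρ g r c) : ℝ) : ℂ) = 1 := by
    rw [← h]
    refine Finset.sum_congr rfl fun c _ => ?_
    rw [Matrix.star_apply, Complex.star_def, Complex.mul_conj]
  exact_mod_cast h'

omit [IsTopologicalGroup G] [CompactSpace G] [MeasurableSpace G] [BorelSpace G] in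
/-- The unitarity column sum `Σ_r |ρ_{rc}|² = 1`. [folklore] -/
theorem sum_normSq_col (hρ : IsSpecialUnitaryModel ρ) (g : G) (c : Fin (2 + n)) :
    ∑ r, Complex.normSq (ρ g r c) = 1 := by
  have hu := IsSpecialUnitaryModel.mem_unitaryGroup ρ hρ g
  rw [Matrix.mem_unitaryGroup_iff'] at hu
  have h := congrFun (congrFun hu c) c
  rw [Matrix.mul_apply, Matrix.one_apply_eq] at h
  have h' : ∑ r, ((Complex.normSq (ρ g r c) : ℝ) : ℂ) = 1 := by
    rw [← h]
    refine Finset.sum_congr rfl fun r _ => ?_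
    rw [Matrix.star_apply, Complex.star_def, Complex.normSq_eq_conj_mul_self]
  exact_mod_cast h'

/-- `Σ_{c} ∫ |ρ₀₀|²|ρ_{r c}|² = ∫ |ρ₀₀|² = 1/N` (row sum against `|ρ₀₀|²`). [folklore] -/
theorem sum_integral_nn_rowSum (hρ : IsSpecialUnitaryModel ρ) (r : Fin (2 + n)) :
    ∑ c, ∫ g, nn (ρ g) 0 0 r c ∂haarProbability G = 1 / (2 + n : ℝ) := by
  rw [← integral_finsetSum _ (fun c _ => integrable_nn ρ hρ.1 0 0 r c)]
  have hpt : ∀ g : G, ∑ c, nn (ρ g) 0 0 r c = Complex.normSq (ρ g 0 0) := fun g => by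
    rw [← Finset.mul_sum, sum_normSq_row ρ hρ g r, mul_one]
  simp_rw [hpt]
  exact HaarFourthMomentSUN.integral_normSq_entry_real ρ hρ 0 0

/-- `Σ_{r} ∫ |ρ₀₀|²|ρ_{r c}|² = 1/N` (column sum against `|ρ₀₀|²`). [folklore] -/
theorem sum_integral_nn_colSum (hρ : IsSpecialUnitaryModel ρ) (c : Fin (2 + n)) :
    ∑ r, ∫ g, nn (ρ g) 0 0 r c ∂haarProbability G = 1 / (2 + n : ℝ) := by
  rw [← integral_finsetSum _ (fun r _ => integrable_nn ρ hρ.1 0 0 r c)]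
  have hpt : ∀ g : G, ∑ r, nn (ρ g) 0 0 r c = Complex.normSq (ρ g 0 0) := fun g => by
    rw [← Finset.mul_sum, sum_normSq_col ρ hρ g c, mul_one]
  simp_rw [hpt]
  exact HaarFourthMomentSUN.integral_normSq_entry_real ρ hρ 0 0

/-- A sum over `Fin (2+n)` splits off the term at `0`; the other terms, all equal to `v`, contribute `(N−1) v`. [folklore] -/
theorem sum_eq_add_of_eq_off_zero {f : Fin (2 + n) → ℝ} {v : ℝ} (h : ∀ i, i ≠ 0 → f i = v) :
    ∑ i, f i = f 0 + (1 + n : ℝ) * v := by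
  rw [← Finset.add_sum_erase Finset.univ f (Finset.mem_univ 0)]
  congr 1
  rw [Finset.sum_congr rfl fun i hi => h i (Finset.ne_of_mem_erase hi), Finset.sum_const, Finset.card_erase_of_mem
    (Finset.mem_univ _), Finset.card_univ, Fintype.card_fin, show 2 + n - 1 = 1 + n by omega, nsmul_eq_mul]
  push_cast
  ring

/-- ★ **`B` (same row): `∫ |ρ_{rc₁}|²|ρ_{rc₂}|² = 1/(N(N+1))`** for `c₁ ≠ c₂`, every `N ≥ 2` (from `A` and the row sum). [folklore] -/
theorem integral_nn_row (hρ : IsSpecialUnitaryModel ρ) (r : Fin (2 + n)) {c₁ c₂ : Fin (2 + n)} (h : c₁ ≠ c₂) :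
    ∫ g, nn (ρ g) r c₁ r c₂ ∂haarProbability G = 1 / ((2 + n : ℝ) * (3 + n)) := by
  rw [integral_nn_rows00 ρ hρ r c₁ c₂, integral_nn_cols01 ρ hρ h 0 0]
  have hs := sum_integral_nn_rowSum ρ hρ 0
  have hoff : ∀ c : Fin (2 + n), c ≠ 0 →
      ∫ g, nn (ρ g) 0 0 0 c ∂haarProbability G = ∫ g, nn (ρ g) 0 0 0 1 ∂haarProbability G :=
    fun c hc => integral_nn_cols01 ρ hρ hc.symm 0 0
  rw [sum_eq_add_of_eq_off_zero hoff, integral_nn_same ρ hρ 0 0] at hs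
  have hpos : (0 : ℝ) < (2 + n : ℝ) * (3 + n) := by positivity
  have hpos1 : (0 : ℝ) < (1 + n : ℝ) := by positivity
  field_simp at hs
  rw [eq_div_iff hpos.ne']
  nlinarith [hs]

/-- ★ **`B` (same column): `∫ |ρ_{r₁c}|²|ρ_{r₂c}|² = 1/(N(N+1))`** for `r₁ ≠ r₂`, every `N ≥ 2`. [folklore] -/
theorem integral_nn_col (hρ : IsSpecialUnitaryModel ρ) (c : Fin (2 + n)) {r₁ r₂ : Fin (2 + n)} (h : r₁ ≠ r₂) :
    ∫ g, nn (ρ g) r₁ c r₂ c ∂haarProbability G = 1 / ((2 + n : ℝ) * (3 + n)) := by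
  rw [integral_nn_cols00 ρ hρ c r₁ r₂, integral_nn_rows01 ρ hρ h 0 0]
  have hs := sum_integral_nn_colSum ρ hρ 0
  have hoff : ∀ r : Fin (2 + n), r ≠ 0 →
      ∫ g, nn (ρ g) 0 0 r 0 ∂haarProbability G = ∫ g, nn (ρ g) 0 0 1 0 ∂haarProbability G :=
    fun r hr => integral_nn_rows01 ρ hρ hr.symm 0 0
  rw [sum_eq_add_of_eq_off_zero hoff, integral_nn_same ρ hρ 0 0] at hs
  have hpos : (0 : ℝ) < (2 + n : ℝ) * (3 + n) := by positivity
  have hpos1 : (0 : ℝ) < (1 + n : ℝ) := by positivity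
  field_simp at hs
  rw [eq_div_iff hpos.ne']
  nlinarith [hs]

/-- ★ **`C`: `∫ |ρ_{r₁c₁}|²|ρ_{r₂c₂}|² = 1/(N²−1)`** for `r₁ ≠ r₂`, `c₁ ≠ c₂`, every `N ≥ 2` (from `B` and the row sum of row `1`).
[folklore] -/
theorem integral_nn_gen (hρ : IsSpecialUnitaryModel ρ) {r₁ r₂ c₁ c₂ : Fin (2 + n)} (hr : r₁ ≠ r₂) (hc : c₁ ≠ c₂) :
    ∫ g, nn (ρ g) r₁ c₁ r₂ c₂ ∂haarProbability G = 1 / ((1 + n : ℝ) * (3 + n)) := by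
  rw [integral_nn_rows01 ρ hρ hr, integral_nn_cols01 ρ hρ hc 0 1]
  have hs := sum_integral_nn_rowSum ρ hρ 1
  have hoff : ∀ c : Fin (2 + n), c ≠ 0 →
      ∫ g, nn (ρ g) 0 0 1 c ∂haarProbability G = ∫ g, nn (ρ g) 0 0 1 1 ∂haarProbability G :=
    fun c hc => integral_nn_cols01 ρ hρ hc.symm 0 1
  rw [sum_eq_add_of_eq_off_zero hoff, integral_nn_col ρ hρ 0 HaarFourthMomentSUN.one_ne_zero_fin.symm] at hs
  have hpos : (0 : ℝ) < (1 + n : ℝ) * (3 + n) := by positivity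
  have hpos2 : (0 : ℝ) < (2 + n : ℝ) * (3 + n) := by positivity
  have hpos1 : (0 : ℝ) < (1 + n : ℝ) := by positivity
  field_simp at hs
  rw [eq_div_iff hpos.ne']
  nlinarith [hs]

/-! ### The diagonal sums `Σ_m ∫ |ρ_mm|² |ρ_ik|²` -/

/-- ★ **`Σ_m ∫ |ρ_mm|²|ρ_ii|² = (N+2)/(N(N+1))`** (`= A + (N−1)C`). [folklore] -/
theorem sum_integral_nn_diag_same (hρ : IsSpecialUnitaryModel ρ) (i : Fin (2 + n)) :
    ∑ m, ∫ g, nn (ρ g) m m i i ∂haarProbability G = (4 + n : ℝ) / ((2 + n : ℝ) * (3 + n)) := by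
  rw [← Finset.add_sum_erase Finset.univ _ (Finset.mem_univ i), integral_nn_same ρ hρ i i]
  have hoff : ∀ m ∈ Finset.univ.erase i, ∫ g, nn (ρ g) m m i i ∂haarProbability G = 1 / ((1 + n : ℝ) * (3 + n)) :=
    fun m hm => integral_nn_gen ρ hρ (Finset.ne_of_mem_erase hm) (Finset.ne_of_mem_erase hm)
  rw [Finset.sum_congr rfl hoff, Finset.sum_const, Finset.card_erase_of_mem (Finset.mem_univ _), Finset.card_univ,
    Fintype.card_fin, show 2 + n - 1 = 1 + n by omega, nsmul_eq_mul]
  have hpos1 : (0 : ℝ) < (1 + n : ℝ) := by positivity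
  push_cast
  field_simp
  ring

/-- ★ **`Σ_m ∫ |ρ_mm|²|ρ_ik|² = (N²−2)/(N(N²−1))`** for `i ≠ k` (`= 2B + (N−2)C`). [folklore] -/
theorem sum_integral_nn_diag_off (hρ : IsSpecialUnitaryModel ρ) {i k : Fin (2 + n)} (hik : i ≠ k) :
    ∑ m, ∫ g, nn (ρ g) m m i k ∂haarProbability G =
      ((2 + n : ℝ) ^ 2 - 2) / ((2 + n : ℝ) * ((1 + n : ℝ) * (3 + n))) := by
  rw [← Finset.add_sum_erase Finset.univ _ (Finset.mem_univ i), integral_nn_row ρ hρ i hik]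
  have hk : k ∈ Finset.univ.erase i := Finset.mem_erase.mpr ⟨hik.symm, Finset.mem_univ k⟩
  rw [← Finset.add_sum_erase _ _ hk, integral_nn_col ρ hρ k hik.symm]
  have hoff : ∀ m ∈ (Finset.univ.erase i).erase k,
      ∫ g, nn (ρ g) m m i k ∂haarProbability G = 1 / ((1 + n : ℝ) * (3 + n)) := fun m hm => by
    have hmk : m ≠ k := Finset.ne_of_mem_erase hm
    have hmi : m ≠ i := Finset.ne_of_mem_erase (Finset.mem_of_mem_erase hm)
    exact integral_nn_gen ρ hρ hmi hmk
  rw [Finset.sum_congr rfl hoff, Finset.sum_const, Finset.card_erase_of_mem hk,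
    Finset.card_erase_of_mem (Finset.mem_univ _), Finset.card_univ, Fintype.card_fin, nsmul_eq_mul]
  have hpos1 : (0 : ℝ) < (1 + n : ℝ) := by positivity
  have e : ((2 + n - 1 - 1 : ℕ) : ℝ) = n := by
    rw [show 2 + n - 1 - 1 = n by omega]
  rw [e]
  field_simp
  ring

end Moments

end Summit.QuantumFields.YangMills.Theorems.ToronCumulantSign
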